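import Summits.RiemannHypothesis.RiemannHypothesis.Theorems.MotivicDoorDiagonalDivergence
import Summits.RiemannHypothesis.RiemannHypothesis.Theorems.MotivicDoorArchLogLaplacianBound
import HarnessLib

/-!
# The decreed diagonal, exactly: `𝔰(f_E, f_E) = −½‖u‖₂² E log E − ½c(u) E + O(1)` (motivic door, cc-3)

Honest framing (cell `pub-rhdoor`, verbatim): lottery ticket at the motivic door; RH probability
negligible; consolation prizes are real: a new semi-local Weil-positivity theorem, or a located gap
in the Connes–Consani programme, plus the ff-door theorem.  NO content about the zeros of `ζ`: every
statement below is an identity or estimate for the functional side of the explicit formula, driven by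
its ARCHIMEDEAN term (Bombieri 2000 Thm. 2, `weilArchTermBombieri_eq_weilArchTerm_holds`); no DATA.

Sequel to `MotivicDoorDiagonalDivergence` (cc-3: `2𝔰(f_E,f_E) ≤ (16R − E(log E − K))‖u‖₂²`, an
inexplicit `K` from Suzuki's small-window law) using seat extrem-1's identity
`W_ℝ(F) = ½𝓔(F) − log(2π)F(0) + ½∫₀^∞ k_r k` (`weilArchTermBombieri_eq_logLaplacian`,
`𝓔 = logLaplacianEnergy`, `|k_r| ≤ 5`).  PROVED here (standard axioms), `k = weilSymm F`:
1. `logLaplacianEnergy_comp_mul`: the EXACT DILATION LAW `𝓔(F(E·)) = 𝓔(F) + k(0) log E` (`E > 0`) —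
   the log-Laplacian energy is `log`-homogeneous (its symbol is `log|ξ|`); and the residual gains
   `E⁻¹`: `‖½∫ k_r(x) k(Ex)‖ ≤ (5/2)E⁻¹∫₀^∞‖k‖` (`norm_archResidual_comp_mul_le`), so
   `W_ℝ(F(E·)) = F(0) log E + (½𝓔(F) − log(2π)F(0)) + O(E⁻¹)` (`weilArchTerm_comp_mul_eq_logLaplacian`).
2. Along Bombieri's unitary dilations `g_η` (`E = 1+η`, `g_η ⋆ g̃_η = (g ⋆ g̃)(E·)`), for `g`
   supported in `[-R, R]` and `E ≥ max(R, 2R/log 2)` (no prime below `log 2`, polar term `O(E⁻¹)`):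
   `|Re Q(g_η) − ‖g‖₂² log E − c(g)| ≤ (16R‖g‖₂² + (5/2)∫₀^∞‖k‖)/E`, `c(g) = ½Re 𝓔(g⋆g̃) − log(2π)‖g‖₂²`
   (`abs_re_weilQuadratic_weilDilate_sub_log_le`, `tendsto_re_weilQuadratic_weilDilate_sub_log`):
   the two-term asymptotic behind `tendsto_re_weilQuadratic_weilDilate_atTop`, Suzuki-free.
3. THE DECREED DIAGONAL (Connes–Consani, arXiv:1805.10501 §3: `D(f)•D(f') = 𝔰(f,f')`; `2𝔰 = P − Re Q`,
   `two_mul_ccPairing_toMul_eq`): for a real test `u` and its mass-preserving approximate identities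
   `u_E(t) = E u(Et)` (`f_E = toMul u_E → (∫u)·δ₁`, `D(f_E) → (∫u)·Δ`), whenever `E log 2 ≥ 2R`,
   `|2𝔰(f_E,f_E) + ‖u‖₂² E log E + c(u) E| ≤ (5/2)∫₀^∞‖k‖` (`abs_two_mul_ccPairing_approxDiagonal_add_le`;
   the polar terms cancel exactly), hence `𝔰(f_E,f_E)/(E log E) → −½‖u‖₂²`
   (`tendsto_ccPairing_approxDiagonal_div_mul_log`).
PRINTED shape now matched with its coefficient: Connes, *An essay on the Riemann Hypothesis*
(arXiv:1509.05576) §4.1 p. 15, "`N(1) = 2 − lim (ω(1+ε) − ω(1))/ε ∼ −½ E log E`, `E = 1/ε`, which is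
`−∞` and in fact reflects … the density of the zeros" — here the same `−½ E log E` (times `‖u‖₂²`, with
the next term `−½c(u)E` and a uniform `O(1)`) comes from the archimedean place alone.  DERIVED reading
for the located gap (G3 of the cell's LOCATED-GAP.md): a Riemann–Roch / intersection theory on a square
of `Spec ℤ` reproducing `𝔰` must renormalise the diagonal by exactly `½‖u‖₂² E log E + ½c(u)E`; a
constraint on the missing object, not evidence about RH.
References: E. Bombieri, Rend. Mat. Acc. Lincei (9) 11 (2000) Thm. 2; A. Connes, arXiv:1509.05576
§4.1; A. Connes, C. Consani, arXiv:1805.10501 §3; H. Chen, T. Weth, arXiv:1710.03416 Thm. 1.1.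
-/

noncomputable section

open Complex Set MeasureTheory Filter Topology Literature.NumberTheory.LFunctions
open Literature.NumberTheory.ConnesConsani2019
open Summit.RiemannHypothesis.RiemannHypothesis.Theorems.MotivicDoor.ArchLogLaplacian

namespace Summit.RiemannHypothesis.RiemannHypothesis.Theorems.MotivicDoor.ConnesConsani

/-! ## 1. The exact dilation law of the log-Laplacian energy -/

section DilationLaw

variable {F : ℝ → ℂ}

/-- Symmetrisation commutes with rescaling: `weilSymm (F(c·)) = (weilSymm F)(c·)`. -/
theorem weilSymm_comp_mul_eq (F : ℝ → ℂ) (c : ℝ) :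
    weilSymm (fun t ↦ F (c * t)) = fun x ↦ weilSymm F (c * x) := by
  funext x; simp only [weilSymm, mul_neg]

/-- **Dilation law, `E ≥ 1`**: `𝓔(F(E·)) = 𝓔(F) + k(0) log E`, `k = weilSymm F` (substitute `y = Ex`
in both integrals of `logLaplacianEnergy` and move the piece `∫₁^E`).  PROVED. -/
theorem logLaplacianEnergy_comp_mul_of_one_le (hF : IsWeilTest F) {E : ℝ} (hE : 1 ≤ E) :
    logLaplacianEnergy (fun t ↦ F (E * t)) =
      logLaplacianEnergy F + weilSymm F 0 * (Real.log E : ℂ) := by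
  have hE0 : 0 < E := one_pos.trans_le hE
  have hEc : (E : ℂ) ≠ 0 := by exact_mod_cast hE0.ne'
  set k : ℝ → ℂ := weilSymm F with hkdef
  have hk : IsWeilTest k := hF.weilSymm
  have hkc : Continuous k := hk.1.continuous
  have hH : IntegrableOn (fun y : ℝ ↦ k y / (y : ℂ)) (Ioi 1) := integrableOn_div_Ioi hk
  have hH1 : IntegrableOn (fun y : ℝ ↦ k y / (y : ℂ)) (Ioc 1 E) := hH.mono_set Ioc_subset_Ioi_self
  have hH2 : IntegrableOn (fun y : ℝ ↦ k y / (y : ℂ)) (Ioi E) := hH.mono_set (Ioi_subset_Ioi hE)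
  have hG1 : IntegrableOn (fun y : ℝ ↦ (k 0 - k y) / (y : ℂ)) (Ioc 0 1) := by
    refine ((integrableOn_sub_div_Ioc hk).neg).congr_fun (fun y _ ↦ ?_) measurableSet_Ioc
    simp only [Pi.neg_apply, ← neg_div, neg_sub]
  have hG2 : IntegrableOn (fun y : ℝ ↦ (k 0 - k y) / (y : ℂ)) (Ioc 1 E) := by
    have hc : ContinuousOn (fun y : ℝ ↦ (k 0 - k y) / (y : ℂ)) (Icc 1 E) :=
      ContinuousOn.div (by fun_prop) Complex.continuous_ofReal.continuousOn fun y hy ↦ by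
        exact_mod_cast (one_pos.trans_le hy.1).ne'
    exact (hc.integrableOn_Icc).mono_set Ioc_subset_Icc_self
  -- (A) `∫₀¹ (k(0) − k(Ex)) dx/x = ∫₀^E (k(0) − k(y)) dy/y`
  have hA : ∫ x in Ioc (0 : ℝ) 1, (k 0 - k (E * x)) / (x : ℂ) =
      ∫ y in Ioc (0 : ℝ) E, (k 0 - k y) / (y : ℂ) := by
    have h1 : ∫ x in Ioc (0 : ℝ) 1, (k 0 - k (E * x)) / (x : ℂ) =
        ∫ x in Ioc (0 : ℝ) 1, (E : ℂ) * ((fun y : ℝ ↦ (k 0 - k y) / (y : ℂ)) (E * x)) := by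
      refine setIntegral_congr_fun measurableSet_Ioc fun x hx ↦ ?_
      have hx : (x : ℂ) ≠ 0 := by exact_mod_cast hx.1.ne'
      simp only [Complex.ofReal_mul]
      field_simp
    rw [h1, integral_const_mul, ← intervalIntegral.integral_of_le zero_le_one,
      intervalIntegral.integral_comp_mul_left (fun y : ℝ ↦ (k 0 - k y) / (y : ℂ)) hE0.ne',
      mul_zero, mul_one, intervalIntegral.integral_of_le hE0.le, Complex.real_smul,
      Complex.ofReal_inv, ← mul_assoc, mul_inv_cancel₀ hEc, one_mul]
  -- (B) `∫₁^∞ k(Ex) dx/x = ∫_E^∞ k(y) dy/y`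
  have hB : ∫ x in Ioi (1 : ℝ), k (E * x) / (x : ℂ) = ∫ y in Ioi E, k y / (y : ℂ) := by
    have h1 : ∫ x in Ioi (1 : ℝ), k (E * x) / (x : ℂ) =
        ∫ x in Ioi (1 : ℝ), (E : ℂ) * ((fun y : ℝ ↦ k y / (y : ℂ)) (E * x)) := by
      refine setIntegral_congr_fun measurableSet_Ioi fun x hx ↦ ?_
      have hx : (x : ℂ) ≠ 0 := by exact_mod_cast (one_pos.trans hx).ne'
      simp only [Complex.ofReal_mul]
      field_simp
    rw [h1, integral_const_mul, integral_comp_mul_left_Ioi (fun y : ℝ ↦ k y / (y : ℂ)) 1 hE0,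
      mul_one, Complex.real_smul, Complex.ofReal_inv, ← mul_assoc, mul_inv_cancel₀ hEc, one_mul]
  -- (C) splitting at `1` and at `E`
  have hC : ∫ y in Ioc (0 : ℝ) E, (k 0 - k y) / (y : ℂ) =
      (∫ y in Ioc (0 : ℝ) 1, (k 0 - k y) / (y : ℂ)) + ∫ y in Ioc (1 : ℝ) E, (k 0 - k y) / (y : ℂ) := by
    rw [← Ioc_union_Ioc_eq_Ioc zero_le_one hE,
      setIntegral_union (Ioc_disjoint_Ioc_of_le le_rfl) measurableSet_Ioc hG1 hG2]
  have hC' : ∫ y in Ioi (1 : ℝ), k y / (y : ℂ) =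
      (∫ y in Ioc (1 : ℝ) E, k y / (y : ℂ)) + ∫ y in Ioi E, k y / (y : ℂ) := by
    rw [← Ioc_union_Ioi_eq_Ioi hE, setIntegral_union Ioc_disjoint_Ioi_same measurableSet_Ioi hH1 hH2]
  -- (D) the moved piece: `∫₁^E (k(0) − k(y)) dy/y = k(0) log E − ∫₁^E k(y) dy/y`
  have hD : ∫ y in Ioc (1 : ℝ) E, (k 0 - k y) / (y : ℂ) =
      k 0 * (Real.log E : ℂ) - ∫ y in Ioc (1 : ℝ) E, k y / (y : ℂ) := by
    have hLr : IntegrableOn (fun y : ℝ ↦ 1 / y) (Ioc 1 E) :=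
      ((continuousOn_const.div continuousOn_id fun y hy ↦
        (one_pos.trans_le hy.1).ne').integrableOn_Icc).mono_set Ioc_subset_Icc_self
    have hL : IntegrableOn (fun y : ℝ ↦ ((1 / y : ℝ) : ℂ)) (Ioc 1 E) := hLr.ofReal
    have e : ∀ y : ℝ, (k 0 - k y) / (y : ℂ) = k 0 * ((1 / y : ℝ) : ℂ) - k y / (y : ℂ) :=
      fun y ↦ by push_cast; ring
    simp_rw [e]
    rw [integral_sub (hL.const_mul (k 0)) hH1, integral_const_mul, integral_complex_ofReal,
      ← intervalIntegral.integral_of_le hE, integral_one_div_of_pos one_pos hE0, div_one]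
  unfold logLaplacianEnergy
  rw [weilSymm_comp_mul_eq F E, ← hkdef]
  simp only [mul_zero]
  rw [hA, hC, hD, hB, hC']
  ring

/-- **Dilation law of the log-Laplacian energy**, every `E > 0`: `𝓔(F(E·)) = 𝓔(F) + k(0) log E`
(`E < 1` from the case `E ≥ 1` applied to `F(E·)` and `E⁻¹`).  PROVED. -/
theorem logLaplacianEnergy_comp_mul (hF : IsWeilTest F) {E : ℝ} (hE : 0 < E) :
    logLaplacianEnergy (fun t ↦ F (E * t)) =
      logLaplacianEnergy F + weilSymm F 0 * (Real.log E : ℂ) := by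
  rcases le_or_gt 1 E with h1 | h1
  · exact logLaplacianEnergy_comp_mul_of_one_le hF h1
  · have hE1 : 1 ≤ E⁻¹ := (one_le_inv₀ hE).2 h1.le
    have h := logLaplacianEnergy_comp_mul_of_one_le (hF.comp_mul hE.ne') hE1
    have e : (fun t ↦ (fun t ↦ F (E * t)) (E⁻¹ * t)) = F := by
      funext t; simp only [← mul_assoc, mul_inv_cancel₀ hE.ne', one_mul]
    rw [e] at h
    simp only [weilSymm_comp_mul_eq, mul_zero, Real.log_inv, Complex.ofReal_neg] at h
    linear_combination -h

/-- **The residual gains `E⁻¹`**: `‖½∫₀^∞ k_r(x) k(Ex) dx‖ ≤ (5/2)E⁻¹∫₀^∞‖k‖` (`|k_r| ≤ 5`).  PROVED. -/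
theorem norm_archResidual_comp_mul_le (hF : IsWeilTest F) {E : ℝ} (hE : 0 < E) :
    ‖(1 / 2 : ℂ) * ∫ x in Ioi (0 : ℝ), (archResidualKernel x : ℂ) * weilSymm F (E * x)‖ ≤
      (5 / 2) / E * ∫ x in Ioi (0 : ℝ), ‖weilSymm F x‖ := by
  have h := norm_archResidual_le (hF.comp_mul hE.ne')
  simp only [weilSymm_comp_mul_eq] at h
  have hI : ∫ x in Ioi (0 : ℝ), ‖weilSymm F (E * x)‖ = E⁻¹ * ∫ x in Ioi (0 : ℝ), ‖weilSymm F x‖ := by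
    have := integral_comp_mul_left_Ioi (fun x ↦ ‖weilSymm F x‖) 0 hE
    rw [mul_zero] at this; rw [this, smul_eq_mul]
  rw [hI] at h
  exact h.trans (le_of_eq (by ring))

/-- **The archimedean term along dilations, exactly** (`E > 0`):
`W_ℝ(F(E·)) = F(0) log E + (½𝓔(F) − log(2π)F(0)) + ½∫₀^∞ k_r(x) k(Ex) dx` (Bombieri's form,
`weilArchTermBombieri_eq_logLaplacian`, the dilation law).  PROVED. -/
theorem weilArchTerm_comp_mul_eq_logLaplacian (hF : IsWeilTest F) {E : ℝ} (hE : 0 < E) :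
    weilArchTerm (fun t ↦ F (E * t)) =
      F 0 * (Real.log E : ℂ) +
        ((1 / 2 : ℂ) * logLaplacianEnergy F - (Real.log (2 * Real.pi) : ℂ) * F 0) +
        (1 / 2 : ℂ) * ∫ x in Ioi (0 : ℝ), (archResidualKernel x : ℂ) * weilSymm F (E * x) := by
  have hFE : IsWeilTest (fun t ↦ F (E * t)) := hF.comp_mul hE.ne'
  rw [← weilArchTermBombieri_eq_weilArchTerm_holds hFE, weilArchTermBombieri_eq_logLaplacian hFE,
    logLaplacianEnergy_comp_mul hF hE, weilSymm_zero, weilSymm_comp_mul_eq]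
  simp only [mul_zero]
  ring

end DilationLaw

/-! ## 2. Weil's form along unitary dilations: `Re Q(g_η) = ‖g‖₂² log E + c(g) + O(E⁻¹)` -/

section Dilates

variable {g : ℝ → ℂ}

/-- **Weil's form of a dilate, exactly** (`F = g ⋆ g̃`, `E = 1+η > 0`, `F_E = F(E·) = g_η ⋆ g̃_η`):
`Q(g_η) = (F̂_E(0) + F̂_E(1)) − Σ_p(F_E) + ‖g‖₂² log E + (½𝓔(F) − log(2π)‖g‖₂²) + ½∫₀^∞ k_r(x)k(Ex)dx`.
PROVED. -/
theorem weilQuadratic_weilDilate_eq_logLaplacian (hg : IsWeilTest g) {η : ℝ} (hη : -1 < η) :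
    weilQuadratic (weilDilate η g) =
      weilPolarTerm (fun t ↦ weilConv g (weilReflect g) ((1 + η) * t)) -
          weilPrimeTerm (fun t ↦ weilConv g (weilReflect g) ((1 + η) * t)) +
        ((((∫ t, ‖g t‖ ^ 2 : ℝ) : ℂ)) * (Real.log (1 + η) : ℂ) +
          ((1 / 2 : ℂ) * logLaplacianEnergy (weilConv g (weilReflect g)) -
            (Real.log (2 * Real.pi) : ℂ) * ((∫ t, ‖g t‖ ^ 2 : ℝ) : ℂ)) +
          (1 / 2 : ℂ) * ∫ x in Ioi (0 : ℝ), (archResidualKernel x : ℂ) *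
            weilSymm (weilConv g (weilReflect g)) ((1 + η) * x)) := by
  rw [weilQuadratic_weilDilate g hη, weilFunctional,
    weilArchTerm_comp_mul_eq_logLaplacian (hg.weilConv hg.weilReflect) (by linarith),
    weilConv_weilReflect_apply_zero]

/-- Real part of `weilQuadratic_weilDilate_eq_logLaplacian`.  PROVED. -/
theorem re_weilQuadratic_weilDilate_eq_logLaplacian (hg : IsWeilTest g) {η : ℝ} (hη : -1 < η) :
    (weilQuadratic (weilDilate η g)).re =
      (weilPolarTerm (fun t ↦ weilConv g (weilReflect g) ((1 + η) * t))).re -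
          (weilPrimeTerm (fun t ↦ weilConv g (weilReflect g) ((1 + η) * t))).re +
        ((∫ t, ‖g t‖ ^ 2) * Real.log (1 + η) +
          (1 / 2 * (logLaplacianEnergy (weilConv g (weilReflect g))).re -
            Real.log (2 * Real.pi) * ∫ t, ‖g t‖ ^ 2) +
          ((1 / 2 : ℂ) * ∫ x in Ioi (0 : ℝ), (archResidualKernel x : ℂ) *
            weilSymm (weilConv g (weilReflect g)) ((1 + η) * x)).re) := by
  rw [weilQuadratic_weilDilate_eq_logLaplacian hg hη]
  have h2 : (1 / 2 : ℂ) = ((1 / 2 : ℝ) : ℂ) := by push_cast; ring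
  simp only [Complex.add_re, Complex.sub_re, ← Complex.ofReal_mul, Complex.ofReal_re,
    Complex.re_ofReal_mul, h2]

/-- **No prime below `log 2`**: for `supp g ⊆ [-R, R]`, `2R ≤ (1+η) log 2` the prime term of
`(g ⋆ g̃)((1+η)·)` vanishes (`supp ⊆ [-2R/(1+η), 2R/(1+η)] ⊆ [-log 2, log 2]`).  PROVED. -/
theorem weilPrimeTerm_dilate_eq_zero (hg : IsWeilTest g) {R η : ℝ} (hη : -1 < η)
    (hsupp : tsupport g ⊆ Icc (-R) R) (hRη : 2 * R ≤ Real.log 2 * (1 + η)) :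
    weilPrimeTerm (fun t ↦ weilConv g (weilReflect g) ((1 + η) * t)) = 0 := by
  have hc : 0 < 1 + η := by linarith
  have hF : IsWeilTest (weilConv g (weilReflect g)) := hg.weilConv hg.weilReflect
  refine weilPrimeTerm_eq_zero_of_tsupport_subset (hF.comp_mul hc.ne').1.continuous ?_
  refine (tsupport_comp_mul_subset _ hc (tsupport_weilConv_weilReflect_subset hg.2 hsupp)).trans ?_
  have h : 2 * R / (1 + η) ≤ Real.log 2 := by rw [div_le_iff₀ hc]; linarith
  exact Icc_subset_Icc (neg_le_neg h) h

/-- **The polar term of a dilate is `O((1+η)⁻¹)`**: `|Re(F̂_E(0) + F̂_E(1))| = |P(g_η)| ≤ 16R(1+η)⁻¹‖g‖₂²`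
for `supp g ⊆ [-R, R]`, `0 < R ≤ 1+η` (`abs_weilPoleForm_le`, `‖g_η‖₂ = ‖g‖₂`).  PROVED. -/
theorem abs_re_weilPolarTerm_dilate_le (hg : IsWeilTest g) {R η : ℝ} (hR : 0 < R) (hη : -1 < η)
    (hsupp : tsupport g ⊆ Icc (-R) R) (hRη : R ≤ 1 + η) :
    |(weilPolarTerm (fun t ↦ weilConv g (weilReflect g) ((1 + η) * t))).re| ≤
      16 * R / (1 + η) * ∫ t, ‖g t‖ ^ 2 := by
  have hc : 0 < 1 + η := by linarith
  rw [← weilConv_weilDilate_weilReflect g hη, weilPolarTerm_weilConv_weilReflect_re (hg.weilDilate hη)]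
  have h := abs_weilPoleForm_le (hg.weilDilate hη) (div_pos hR hc) (by rwa [div_le_one hc])
    (tsupport_weilDilate_subset g hη hsupp)
  rw [integral_norm_sq_weilDilate g hη] at h
  exact h.trans (le_of_eq (by ring))

/-- **Two-term asymptotic of Weil's form along dilations, with rate**: for `g` supported in `[-R, R]`
(`R > 0`), `F = g ⋆ g̃`, `k = weilSymm F`, `1+η ≥ R`, `(1+η) log 2 ≥ 2R`:
`|Re Q(g_η) − ‖g‖₂² log(1+η) − (½Re 𝓔(F) − log(2π)‖g‖₂²)| ≤ (16R‖g‖₂² + (5/2)∫₀^∞‖k‖)/(1+η)`.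
RH-free, Suzuki-free: only Bombieri's archimedean term enters.  PROVED. -/
theorem abs_re_weilQuadratic_weilDilate_sub_log_le (hg : IsWeilTest g) {R : ℝ} (hR : 0 < R)
    (hsupp : tsupport g ⊆ Icc (-R) R) {η : ℝ} (hη : -1 < η) (hRη : R ≤ 1 + η)
    (hRη' : 2 * R ≤ Real.log 2 * (1 + η)) :
    |(weilQuadratic (weilDilate η g)).re - (∫ t, ‖g t‖ ^ 2) * Real.log (1 + η) -
        (1 / 2 * (logLaplacianEnergy (weilConv g (weilReflect g))).re -
          Real.log (2 * Real.pi) * ∫ t, ‖g t‖ ^ 2)| ≤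
      (16 * R * (∫ t, ‖g t‖ ^ 2) +
          5 / 2 * ∫ x in Ioi (0 : ℝ), ‖weilSymm (weilConv g (weilReflect g)) x‖) / (1 + η) := by
  have hc : 0 < 1 + η := by linarith
  have hF : IsWeilTest (weilConv g (weilReflect g)) := hg.weilConv hg.weilReflect
  rw [re_weilQuadratic_weilDilate_eq_logLaplacian hg hη, weilPrimeTerm_dilate_eq_zero hg hη hsupp hRη',
    Complex.zero_re, sub_zero]
  have hP := abs_re_weilPolarTerm_dilate_le hg hR hη hsupp hRη
  have hRes := norm_archResidual_comp_mul_le hF hc (F := weilConv g (weilReflect g))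
  have hRes' := (Complex.abs_re_le_norm _).trans hRes
  rw [abs_le] at hP hRes' ⊢
  have e : (16 * R * (∫ t, ‖g t‖ ^ 2) + 5 / 2 * ∫ x in Ioi (0 : ℝ), ‖weilSymm (weilConv g (weilReflect g)) x‖)
      / (1 + η) = 16 * R / (1 + η) * (∫ t, ‖g t‖ ^ 2) +
        (5 / 2) / (1 + η) * ∫ x in Ioi (0 : ℝ), ‖weilSymm (weilConv g (weilReflect g)) x‖ := by field_simp
  rw [e]
  constructor <;> linarith [hP.1, hP.2, hRes'.1, hRes'.2]

/-- **`Re Q(g_η) − ‖g‖₂² log(1+η) → ½Re 𝓔(g ⋆ g̃) − log(2π)‖g‖₂²`**: the constant behind the log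
divergence of `tendsto_re_weilQuadratic_weilDilate_atTop`.  PROVED. -/
theorem tendsto_re_weilQuadratic_weilDilate_sub_log (hg : IsWeilTest g) {R : ℝ} (hR : 0 < R)
    (hsupp : tsupport g ⊆ Icc (-R) R) :
    Tendsto (fun η : ℝ ↦ (weilQuadratic (weilDilate η g)).re - (∫ t, ‖g t‖ ^ 2) * Real.log (1 + η))
      atTop (𝓝 (1 / 2 * (logLaplacianEnergy (weilConv g (weilReflect g))).re -
        Real.log (2 * Real.pi) * ∫ t, ‖g t‖ ^ 2)) := by
  set c : ℝ := 1 / 2 * (logLaplacianEnergy (weilConv g (weilReflect g))).re -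
    Real.log (2 * Real.pi) * ∫ t, ‖g t‖ ^ 2
  set C : ℝ := 16 * R * (∫ t, ‖g t‖ ^ 2) +
    5 / 2 * ∫ x in Ioi (0 : ℝ), ‖weilSymm (weilConv g (weilReflect g)) x‖
  have h1 : Tendsto (fun η : ℝ ↦ 1 + η) atTop atTop := tendsto_atTop_add_const_left atTop 1 tendsto_id
  have hC : Tendsto (fun η : ℝ ↦ C / (1 + η)) atTop (𝓝 0) := tendsto_const_nhds.div_atTop h1
  have hr : Tendsto (fun η : ℝ ↦ (weilQuadratic (weilDilate η g)).re -
      (∫ t, ‖g t‖ ^ 2) * Real.log (1 + η) - c) atTop (𝓝 0) := by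
    refine squeeze_zero_norm' ?_ hC
    filter_upwards [eventually_ge_atTop (max R (2 * R / Real.log 2) - 1)] with η hη
    have hRη : R ≤ 1 + η := by linarith [le_max_left R (2 * R / Real.log 2)]
    have hη1 : -1 < η := by linarith
    have hl2 : 0 < Real.log 2 := Real.log_pos one_lt_two
    have hRη' : 2 * R ≤ Real.log 2 * (1 + η) := by
      have : 2 * R / Real.log 2 ≤ 1 + η := by linarith [le_max_right R (2 * R / Real.log 2)]
      rw [div_le_iff₀ hl2] at this; linarith
    rw [Real.norm_eq_abs]
    exact abs_re_weilQuadratic_weilDilate_sub_log_le hg hR hsupp hη1 hRη hRη'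
  simpa only [sub_add_cancel, zero_add] using hr.add_const c

end Dilates

/-! ## 3. The decreed diagonal: `2𝔰(f_E, f_E) = −‖u‖₂² E log E − c(u) E + O(1)` -/

section Diagonal

variable {u : ℝ → ℝ}

/-- **The diagonal of the Riemann–Roch strategy, to `O(1)`.**  For a real test `u` supported in
`[-R, R]`, `u_E(t) = E u(Et)` (`E = 1+η`; `f_E = toMul u_E → (∫u)·δ₁`), `F = u ⋆ ũ`, `k = weilSymm F`,
`c(u) = ½Re 𝓔(F) − log(2π)‖u‖₂²`: whenever `E log 2 ≥ 2R`,
`|2𝔰(f_E,f_E) + ‖u‖₂² E log E + c(u) E| ≤ (5/2)∫₀^∞‖k‖` (`2𝔰 = P − Re Q`; `P(u_E) = E·Re(F̂_E(0)+F̂_E(1))`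
cancels the polar term of `Re Q(u_E) = E·Re Q(g_η)`; no prime below `log 2`; residual `E·O(E⁻¹)`).
Connes's "`N(1) ∼ −½ E log E`" with its coefficient and next term.  PROVED; no RH content. -/
theorem abs_two_mul_ccPairing_approxDiagonal_add_le (hu : IsWeilTest fun t ↦ (u t : ℂ)) {R : ℝ}
    (hsupp : tsupport (fun t ↦ (u t : ℂ)) ⊆ Icc (-R) R) {η : ℝ} (hη : -1 < η)
    (hRη : 2 * R ≤ Real.log 2 * (1 + η)) :
    |2 * ccPairing (toMul fun t ↦ (1 + η) * u ((1 + η) * t))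
          (toMul fun t ↦ (1 + η) * u ((1 + η) * t)) +
        (∫ t, ‖(u t : ℂ)‖ ^ 2) * ((1 + η) * Real.log (1 + η)) +
        (1 / 2 * (logLaplacianEnergy
            (weilConv (fun t ↦ (u t : ℂ)) (weilReflect fun t ↦ (u t : ℂ)))).re -
          Real.log (2 * Real.pi) * ∫ t, ‖(u t : ℂ)‖ ^ 2) * (1 + η)| ≤
      5 / 2 * ∫ x in Ioi (0 : ℝ),
        ‖weilSymm (weilConv (fun t ↦ (u t : ℂ)) (weilReflect fun t ↦ (u t : ℂ))) x‖ := by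
  have hc : 0 < 1 + η := by linarith
  set g : ℝ → ℂ := fun t ↦ (u t : ℂ)
  have hF : IsWeilTest (weilConv g (weilReflect g)) := hu.weilConv hu.weilReflect
  -- `2𝔰 = P(u_E) − Re Q(u_E)` and `Re Q(u_E) = E · Re Q(weilDilate η u)`
  rw [two_mul_ccPairing_toMul_eq (isWeilTest_approxDiagonal hu hη),
    re_weilQuadratic_approxDiagonal u hη, re_weilQuadratic_weilDilate_eq_logLaplacian hu hη,
    weilPrimeTerm_dilate_eq_zero hu hη hsupp hRη, Complex.zero_re, sub_zero]
  -- `P(u_E) = E · P(weilDilate η u) = E · Re(polar term of F_E)`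
  have hP : weilPoleForm (fun t ↦ (((1 + η) * u ((1 + η) * t) : ℝ) : ℂ)) =
      (1 + η) * (weilPolarTerm (fun t ↦ weilConv g (weilReflect g) ((1 + η) * t))).re := by
    rw [ofReal_approxDiagonal_eq u hη, ← weilConv_weilDilate_weilReflect g hη,
      weilPolarTerm_weilConv_weilReflect_re (hu.weilDilate hη)]
    set w : ℝ → ℂ := weilDilate η g
    have e : ∀ m : ℝ → ℂ, ∫ t : ℝ, (Real.sqrt (1 + η) : ℂ) * w t * m t =
        (Real.sqrt (1 + η) : ℂ) * ∫ t : ℝ, w t * m t := fun m ↦ by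
      rw [← integral_const_mul]
      exact integral_congr_ae (Eventually.of_forall fun t ↦ by ring)
    unfold weilPoleForm
    rw [e, e, norm_mul, norm_mul, mul_pow, mul_pow, Complex.norm_real,
      Real.norm_of_nonneg (Real.sqrt_nonneg _), Real.sq_sqrt hc.le]
    ring
  rw [hP]
  -- the residual is `E · O(E⁻¹)`
  have hRes := norm_archResidual_comp_mul_le hF hc
  have hRes' := (Complex.abs_re_le_norm _).trans hRes
  rw [abs_le] at hRes' ⊢
  have e : (1 + η) * (5 / 2 / (1 + η) * ∫ x in Ioi (0 : ℝ), ‖weilSymm (weilConv g (weilReflect g)) x‖)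
      = 5 / 2 * ∫ x in Ioi (0 : ℝ), ‖weilSymm (weilConv g (weilReflect g)) x‖ := by field_simp
  have h1 := mul_le_mul_of_nonneg_left hRes'.1 hc.le
  have h2 := mul_le_mul_of_nonneg_left hRes'.2 hc.le
  rw [e] at h2
  rw [mul_neg, e] at h1
  constructor <;> nlinarith [h1, h2]

/-- **`𝔰(f_E,f_E) ∼ −½‖u‖₂²·E log E`**: the decreed self-intersections of the approximants of `(∫u)·Δ`,
over `E log E`, tend to `−½‖u‖₂²`.  PROVED. -/
theorem tendsto_ccPairing_approxDiagonal_div_mul_log (hu : IsWeilTest fun t ↦ (u t : ℂ)) {R : ℝ}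
    (hsupp : tsupport (fun t ↦ (u t : ℂ)) ⊆ Icc (-R) R) :
    Tendsto (fun η : ℝ ↦ ccPairing (toMul fun t ↦ (1 + η) * u ((1 + η) * t))
        (toMul fun t ↦ (1 + η) * u ((1 + η) * t)) / ((1 + η) * Real.log (1 + η)))
      atTop (𝓝 (-(1 / 2) * ∫ t, ‖(u t : ℂ)‖ ^ 2)) := by
  set N : ℝ := ∫ t, ‖(u t : ℂ)‖ ^ 2
  set c : ℝ := 1 / 2 * (logLaplacianEnergy
      (weilConv (fun t ↦ (u t : ℂ)) (weilReflect fun t ↦ (u t : ℂ)))).re - Real.log (2 * Real.pi) * N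
  set C : ℝ := 5 / 2 * ∫ x in Ioi (0 : ℝ),
    ‖weilSymm (weilConv (fun t ↦ (u t : ℂ)) (weilReflect fun t ↦ (u t : ℂ))) x‖
  set s : ℝ → ℝ := fun η ↦ 2 * ccPairing (toMul fun t ↦ (1 + η) * u ((1 + η) * t))
    (toMul fun t ↦ (1 + η) * u ((1 + η) * t)) with hsdef
  have h1 : Tendsto (fun η : ℝ ↦ 1 + η) atTop atTop := tendsto_atTop_add_const_left atTop 1 tendsto_id
  have hlog : Tendsto (fun η : ℝ ↦ Real.log (1 + η)) atTop atTop := Real.tendsto_log_atTop.comp h1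
  have hEl : Tendsto (fun η : ℝ ↦ (1 + η) * Real.log (1 + η)) atTop atTop := h1.atTop_mul_atTop₀ hlog
  have hT1 : Tendsto (fun η : ℝ ↦ (s η + N * ((1 + η) * Real.log (1 + η)) + c * (1 + η)) /
      ((1 + η) * Real.log (1 + η))) atTop (𝓝 0) := by
    refine squeeze_zero_norm' ?_
      ((tendsto_const_nhds : Tendsto (fun _ : ℝ ↦ C) atTop (𝓝 C)).div_atTop hEl)
    have hl2 : 0 < Real.log 2 := Real.log_pos one_lt_two
    filter_upwards [eventually_ge_atTop (max 0 (2 * R / Real.log 2 - 1))] with η hη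
    have hη0 : 0 ≤ η := le_trans (le_max_left _ _) hη
    have hη1 : -1 < η := by linarith
    have hRη : 2 * R ≤ Real.log 2 * (1 + η) := by
      have : 2 * R / Real.log 2 ≤ 1 + η := by linarith [le_max_right 0 (2 * R / Real.log 2 - 1)]
      rw [div_le_iff₀ hl2] at this; linarith
    have hden : 0 ≤ (1 + η) * Real.log (1 + η) :=
      mul_nonneg (by linarith) (Real.log_nonneg (by linarith))
    rw [norm_div, Real.norm_eq_abs, Real.norm_eq_abs, abs_of_nonneg hden]
    exact div_le_div_of_nonneg_right
      (abs_two_mul_ccPairing_approxDiagonal_add_le hu hsupp hη1 hRη) hden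
  have hT2 : Tendsto (fun η : ℝ ↦ c / Real.log (1 + η)) atTop (𝓝 0) := tendsto_const_nhds.div_atTop hlog
  have hT : Tendsto (fun η : ℝ ↦ 1 / 2 * ((s η + N * ((1 + η) * Real.log (1 + η)) + c * (1 + η)) /
      ((1 + η) * Real.log (1 + η)) - c / Real.log (1 + η)) - 1 / 2 * N) atTop
      (𝓝 (1 / 2 * (0 - 0) - 1 / 2 * N)) :=
    ((hT1.sub hT2).const_mul (1 / 2)).sub_const (1 / 2 * N)
  rw [show -(1 / 2) * N = 1 / 2 * (0 - 0) - 1 / 2 * N by ring]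
  refine hT.congr' ?_
  filter_upwards [eventually_gt_atTop (0 : ℝ)] with η hη
  have hE : (1 + η) ≠ 0 := by linarith
  have hl : Real.log (1 + η) ≠ 0 := (Real.log_pos (by linarith)).ne'
  field_simp
  ring

end Diagonal

end Summit.RiemannHypothesis.RiemannHypothesis.Theorems.MotivicDoor.ConnesConsani
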